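import Mathlib.Algebra.MvPolynomial.Equiv
import Mathlib.Algebra.Algebra.Hom.Rat
import Mathlib.Analysis.Complex.Basic
import Mathlib.Data.Fin.VecNotation
import HarnessLib

/-!
# Bridge: `ℚ[X₀, X₁]` as iterated univariate polynomials `ℚ[Y][X]`, with complex evaluation

The relation files of the tree (`RationalCoordRelations`, `ZariskiDimCoordRelations`) produce
rational relations as elements of `MvPolynomial (Fin 2) ℚ` evaluated by `aeval ![x, y]`, while the
asymptotic lemmas `CuspValueAlgebraic` / `CuspSlopeAlgebraic` consume a bivariate polynomial in the
iterated form `P ∈ ℚ[Y][X]` evaluated by mapping the coefficients to `ℂ[Y]`, substituting `Y = y`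
and then `X = x`. This file provides the dictionary (`exists_bivariate_of_mvPolynomial`): every
nonzero `P ∈ ℚ[X₀, X₁]` has a nonzero iterated form `Q` with `Q(x, y) = P(x, y)` for all complex
`x, y` (the outer variable is `X₀`). Implementation: Mathlib's `finSuccEquiv` followed by
`uniqueAlgEquiv` on the coefficients; the evaluation identity is checked on generators
(`MvPolynomial.algHom_ext`). [folklore]
-/

noncomputable section

open MvPolynomial

namespace Literature.NumberTheory.Transcendental

/-- **Iterated form of a bivariate rational polynomial.** For every nonzero `P ∈ ℚ[X₀, X₁]` there
is a nonzero `Q ∈ ℚ[Y][X]` with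
`eval₂ (evalRingHom y) x (Q.map (mapRingHom (algebraMap ℚ ℂ))) = aeval ![x, y] P`
for all `x y : ℂ`. [folklore] -/
theorem exists_bivariate_of_mvPolynomial (P : MvPolynomial (Fin 2) ℚ) (hP : P ≠ 0) :
    ∃ Q : Polynomial (Polynomial ℚ), Q ≠ 0 ∧ ∀ x y : ℂ,
      (Q.map (Polynomial.mapRingHom (algebraMap ℚ ℂ))).eval₂ (Polynomial.evalRingHom y) x =
        aeval ![x, y] P := by
  classical
  -- the algebra isomorphism `ℚ[X₀, X₁] ≃ ℚ[Y][X]` (outer variable `X₀`)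
  let E : MvPolynomial (Fin 2) ℚ ≃ₐ[ℚ] Polynomial (Polynomial ℚ) :=
    (finSuccEquiv ℚ 1).trans (Polynomial.mapAlgEquiv (uniqueAlgEquiv ℚ (Fin 1)))
  refine ⟨E P, fun h0 => hP (E.injective (by rw [h0, map_zero])), fun x y => ?_⟩
  -- complex evaluation of the iterated form, as a `ℚ`-algebra homomorphism
  let ev : Polynomial (Polynomial ℚ) →+* ℂ :=
    Polynomial.eval₂RingHom (Polynomial.eval₂RingHom (algebraMap ℚ ℂ) y) x
  have hev : ∀ Q : Polynomial (Polynomial ℚ),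
      (Q.map (Polynomial.mapRingHom (algebraMap ℚ ℂ))).eval₂ (Polynomial.evalRingHom y) x =
        ev Q := by
    intro Q
    rw [Polynomial.eval₂_map]
    change _ = Polynomial.eval₂ _ x Q
    congr 1
    refine Polynomial.ringHom_ext (fun a => ?_) ?_
    · simp
    · simp
  rw [hev]
  -- compare the two `ℚ`-algebra maps `ℚ[X₀, X₁] → ℂ` on the generators
  have key : (ev.toRatAlgHom.comp (E : MvPolynomial (Fin 2) ℚ →ₐ[ℚ] Polynomial (Polynomial ℚ))) =
      MvPolynomial.aeval (![x, y] : Fin 2 → ℂ) := by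
    refine MvPolynomial.algHom_ext fun i => ?_
    fin_cases i
    · -- `X₀ ↦ X ↦ x`
      simp [E, ev, finSuccEquiv_X_zero]
    · -- `X₁ ↦ C Y ↦ y`
      have h1 : (finSuccEquiv ℚ 1) (X (1 : Fin 2)) = Polynomial.C (X (0 : Fin 1)) :=
        finSuccEquiv_X_succ (j := (0 : Fin 1))
      simp [E, ev, h1]
  have := congrArg (fun φ => φ P) key
  simpa using this

end Literature.NumberTheory.Transcendental

end
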